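import Literature.NumberTheory.EllipticCurves.Rank1Residual.MuLambdaCarriers
import Literature.NumberTheory.EllipticCurves.CyclotomicIwasawaMainTheoremIrreducibleMuZeroProofs
import HarnessLib

/-!
# The carrier «`μ(X) ≤ μ(X₀)`» of a pair `(E, p)` (the `μ` of the Selmer group is carried by the FINE
# Selmer group), and the per-pair engine «`μ(X) = 0` ⟹ Kato's integral divisibility» — definitions and
# proved lemmas only

Topic `NumberTheory/EllipticCurves/Rank1Residual` (namespace = path; companion of `MuLambdaCarriers.lean`
§2, §3, §5).  Cell `bsd-f3-mu` (D-0131 (3)), typer seat; transcription of the `-es` lens's generation-5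
carrier (MEMO-es §26, `HOME/es/Sketch6.lean` sha16 f03ae372678c37c1, rc 0; refuter `-ref1` seventh pass:
SURVIVES, BC7 3/3 CLEAN; refuter `-ref2` g7 row es-C6: for irreducible `E[p]` the statement is Ray's
Conj. 5.3 at `(E[p], F̄⁺)`).  ONE predicate with a body and PROVED lemmas; nothing is asserted about any
pair; no new named fact.  The class-wide statement on X9 is an obligation node Summits-side
(`SmallImageMu/MuLeFineMu.lean`).

THE CHART (Kato §17.13, paper-level modulo F1).  Along `z ↦ loc_p z ↦ Col(loc_p z) = L_p(E)` the analytic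
`μ` splits as `μ(L_p) = δ + e + c` with `δ = length_(p)(𝐇¹/Λz)`, `e = length_(p)(P / loc 𝐇¹)`,
`c = length_(p)(Λ / col P)`, and `μ(X) = e + μ(X₀)` from `0 → P/loc 𝐇¹ → X → X₀ → 0`; so «`e = 0`» ⟺
«`μ(X) ≤ μ(X₀)`» (the reverse inequality is the surjection `X ↠ X₀`).  For irreducible `E[p]` this is the
content of Ray's Conj. 5.3 (the residual quotient `S_{E[p]}(ℚ_∞)/S⁰_{E[p]}(ℚ_∞)` is finite), by his
Thm. 5.4; off the irreducible locus it is FALSE (`(X₀(11), 5)`: positive Selmer `μ`, zero fine `μ`).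

* `MuLeFineMuAt W p` — for all cyclotomic data `(κ, γ)`, every dual Selmer datum `D` and every finitely
  generated torsion dual fine datum `Y`: `D.mu ≤ μ(Y.X)` (verbatim the audited Sketch6).
* `MuAlgZeroAt.muLeFineMuAt` (trivial), `MuLeFineMuAt.muAlgZeroAt_of_fineMuZeroAt` (`μ(X) ≤ μ(X₀) = 0`).
* `MuAlgZeroAt.muDefectNonposAt` / `MuAlgZeroAt.katoDivisibilityAt` — **`μ(X) = 0` at a pair `p ≥ 5`,
  good ordinary, `E[p]` irreducible ⟹ the BCS `μ`-defect `k ≤ 0` ⟹ Kato's integral divisibility at the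
  pair** (BCS (a): `ι g = p^k L_p`; `μ(g) = 0` is unit content; `L_p ∈ Λ` by Greenberg–Vatsal Prop. 3.7;
  `exponent_nonpos_of_hasUnitContent`).  The reading «Greenberg's `μ = 0` at the pair already gives the
  cell's crux at the pair».
* `MuLeFineMuAt.katoDivisibilityAt_of_conjAAt` — the per-pair engine of the `e = 0` road: statement (A)
  (`μ(X₀) = 0`, T0) ∧ `μ(X) ≤ μ(X₀)` ⟹ `μ(X) = 0` ⟹ divisibility (the finitely generated torsion fine
  datum discharged by `exists_fineSelmerDualData_finite_isTorsion`).

References: [Kato2004Asterisque] §17.13 (pp. 279–280), Thm. 12.4; [Ray2023] Conj. 5.3, Thm. 5.4, Cor. 5.5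
(arXiv:2308.06673 pp. 4, 13); [GreenbergVatsal2000] p. 2 (1)–(2), Prop. 3.7; [BurungaleCastellaSkinner2025]
Thm. 1.1.2 (a); [GreenbergLNM1716] Conj. 1.11; HOME MEMO-es.md §9, §26, es/Sketch6.lean.
-/

noncomputable section

open scoped Classical MatrixGroups ModularForm

open CongruenceSubgroup WeierstrassCurve Literature.NumberTheory.EllipticCurves
  Literature.NumberTheory.EllipticCurves.ModularForms
  Literature.NumberTheory.EllipticCurves.GreenbergVatsal2000

namespace Literature.NumberTheory.EllipticCurves.Rank1Residual

/-! ### §1 The carrier -/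

/-- **`MuLeFineMuAt W p` — «`e = 0`»: the `μ` of `X(E/ℚ_∞)` is carried by the fine Selmer group** (a
PREDICATE on pairs; nothing asserted).  For all cyclotomic data `(κ, γ)`, every dual Selmer datum `D` of
`Sel(ℚ_∞, E[p^∞])` and every finitely generated torsion dual fine datum `Y` of `Sel₀(ℚ_∞, E[p^∞])`:
`μ(D.X) ≤ μ(Y.X)`.  (`D.mu` unguarded as in `MuAlgZeroAt`; `Y` guarded as in `FineMuZeroAt`; the reverse
inequality is the surjection `X ↠ X₀`, Kato §17.13.)  Verbatim the audited `HOME/es/Sketch6.lean`.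
[cite: Kato2004Asterisque, §17.13 (pp. 279–280) — the sequence `0 → P/loc 𝐇¹ → X → X₀ → 0`; shape]
[cite: Ray2023, Conj. 5.3 and Thm. 5.4 (arXiv:2308.06673 p. 13) — the printed statement it transcribes for irreducible `E[p]`] -/
def MuLeFineMuAt (W : WeierstrassCurve ℚ) [W.IsElliptic] (p : ℕ) [Fact p.Prime] : Prop :=
  ∀ (κ : ZpExtension ℚ p) (γ : Field.absoluteGaloisGroup ℚ),
    κ.IsCyclotomic → κ.IsTopGenerator γ → IsCyclotomicVariable p γ →
    ∀ (D : W.SelmerDualData κ γ) (Y : W.FineSelmerDualData κ γ),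
      Module.Finite (IwasawaAlgebra p) Y.X → Module.IsTorsion (IwasawaAlgebra p) Y.X →
      D.mu ≤ muInvariant p Y.X

variable {W : WeierstrassCurve ℚ} [W.IsElliptic] {p : ℕ} [Fact p.Prime]

/-- `μ(X) = 0` at the pair ⟹ `μ(X) ≤ μ(X₀)` at the pair (trivially: `0 ≤ μ(Y)`).
[cite: Kato2004Asterisque, §17.13 (pp. 279–280)] -/
theorem MuAlgZeroAt.muLeFineMuAt (h : MuAlgZeroAt W p) : MuLeFineMuAt W p := by
  intro κ γ hκ hγ hγ' D Y _ _
  rw [h κ γ hκ hγ hγ' D]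
  exact Nat.zero_le _

/-- **`μ(X) ≤ μ(X₀)` ∧ pointwise `μ(X₀) = 0` ⟹ `μ(X) = 0` at the pair**, granted a finitely generated
torsion fine datum over every cyclotomic datum (Kato Thm. 12.4; discharged on the good ordinary scope by
`exists_fineSelmerDualData_finite_isTorsion`). [cite: Kato2004Asterisque, Thm. 12.4 and §17.13 (pp. 279–280)] -/
theorem MuLeFineMuAt.muAlgZeroAt_of_fineMuZeroAt (h6 : MuLeFineMuAt W p) (h0 : FineMuZeroAt W p)
    (hY : ∀ (κ : ZpExtension ℚ p) (γ : Field.absoluteGaloisGroup ℚ),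
      κ.IsCyclotomic → κ.IsTopGenerator γ → IsCyclotomicVariable p γ →
      ∃ Y : W.FineSelmerDualData κ γ,
        Module.Finite (IwasawaAlgebra p) Y.X ∧ Module.IsTorsion (IwasawaAlgebra p) Y.X) :
    MuAlgZeroAt W p := by
  intro κ γ hκ hγ hγ' D
  obtain ⟨Y, hYf, hYt⟩ := hY κ γ hκ hγ hγ'
  have h := h6 κ γ hκ hγ hγ' D Y hYf hYt
  rw [h0 κ γ hκ hγ hγ' Y hYf hYt] at h
  exact Nat.le_zero.mp h

/-! ### §2 `μ(X) = 0` at the pair ⟹ the `μ`-defect `k ≤ 0` ⟹ Kato's integral divisibility at the pair -/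

section MuZeroEngine

variable [W.IsGloballyMinimal]

/-- **`μ(X(E/ℚ_∞)) = 0` ⟹ the BCS `μ`-defect is `≤ 0`** at a pair `p ≥ 5`, good ordinary, `E[p]`
irreducible: with `ch_Λ X = (g)`, `ι g = p^k · L_p(f, α)` (any such presentation), `μ(X) = 0` makes
`g` of unit content (Greenberg–Vatsal (2)), and `L_p(f, α) ∈ Λ` (Prop. 3.7, tree theorem
`padicLFunction_mem_integral_holds`) forces `k ≤ 0` (`exponent_nonpos_of_hasUnitContent`); the torsion
of `X` is BCS (a) clause 1. [cite: GreenbergVatsal2000, p. 2 (1)–(2) and Prop. 3.7]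
[cite: BurungaleCastellaSkinner2025, Thm. 1.1.2 (a) (p. 2 of arXiv:2405.00270v2)] -/
theorem MuAlgZeroAt.muDefectNonposAt (hBCS : burungale_castella_skinner_charIdeal_eq_padicLFunction)
    (hp : 5 ≤ p) (hgood : W.HasGoodReductionAtPrime p) (hord : ¬ (p : ℤ) ∣ W.frobeniusTrace p)
    (hirr : W.HasIrreducibleModPGaloisRep p) (h : MuAlgZeroAt W p) : MuDefectNonposAt W p := by
  intro κ γ N _ f hκ hγ hγ' hf D g k hg hι
  have hp2 : p ≠ 2 := by omega
  have hordp : IsOrdinaryAt W p := ⟨hgood, hord⟩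
  haveI : Module.Finite (IwasawaAlgebra p) D.X := D.module_finite_holds hγ
  have hX : D.IsTorsion := (hBCS W p κ γ f hp hgood hord hirr hκ hγ hγ' hf D).1
  have hug : HasUnitContent g := h.hasUnitContent_of_charIdeal_eq hκ hγ hγ' D hX hg
  have hint : ∀ n : ℕ, ‖PowerSeries.coeff n (padicLFunction f (unitRoot W p : ℚ_[p]))‖ ≤ 1 := by
    intro n
    rw [coeff_padicLFunction]
    exact padicLFunction_mem_integral_holds hp2 hordp hf hirr n
  exact exponent_nonpos_of_hasUnitContent g _ k hι hint hug

/-- **`μ(X(E/ℚ_∞)) = 0` ⟹ Kato's integral divisibility at the pair** (`KatoDivisibilityAt`: some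
`g ∈ ch_Λ X` with `ι g = L_p(f, α)`), at `p ≥ 5` good ordinary with `E[p]` irreducible, granted BCS (a):
`k ≤ 0` (`MuAlgZeroAt.muDefectNonposAt`) and `MuDefectNonposAt.katoDivisibilityAt`.  Greenberg's `μ = 0`
at the pair thus already yields the cell's crux at the pair.
[cite: GreenbergVatsal2000, Prop. 3.7] [cite: BurungaleCastellaSkinner2025, Thm. 1.1.2 (a) (p. 2 of arXiv:2405.00270v2)] -/
theorem MuAlgZeroAt.katoDivisibilityAt (hBCS : burungale_castella_skinner_charIdeal_eq_padicLFunction)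
    (hp : 5 ≤ p) (hgood : W.HasGoodReductionAtPrime p) (hord : ¬ (p : ℤ) ∣ W.frobeniusTrace p)
    (hirr : W.HasIrreducibleModPGaloisRep p) (h : MuAlgZeroAt W p) : KatoDivisibilityAt W p :=
  (h.muDefectNonposAt hBCS hp hgood hord hirr).katoDivisibilityAt hBCS hp hgood hord hirr

/-- **The per-pair engine of the «`e = 0`» road: `μ(X) ≤ μ(X₀)` ∧ statement (A) ⟹ Kato's integral
divisibility at the pair**, at `p ≥ 5` good ordinary with `E[p]` irreducible, granted BCS (a),
modularity and F1 (only to produce a finitely generated torsion fine datum): (A) ⟹ `μ(X₀) = 0` (T0,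
`ConjAAt.fineMuZeroAt`), `e = 0` lifts it to `μ(X) = 0`, then `MuAlgZeroAt.katoDivisibilityAt`.  Ray's
Cor. 5.5 («Greenberg ⟺ (A)» for irreducible `ρ̄`, conditional on Conj. 5.3) with the conjunct explicit.
[cite: Ray2023, Cor. 5.5 (arXiv:2308.06673 p. 4)] [cite: Kato2004Asterisque, Thm. 12.4 and §17.13] -/
theorem MuLeFineMuAt.katoDivisibilityAt_of_conjAAt
    (hBCS : burungale_castella_skinner_charIdeal_eq_padicLFunction)
    (hmodP : nonempty_modularParametrizationData)
    (hfine : Kato2004.exists_divisibilityInputs_fineQuotient) (hp : 5 ≤ p)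
    (hgood : W.HasGoodReductionAtPrime p) (hord : ¬ (p : ℤ) ∣ W.frobeniusTrace p)
    (hirr : W.HasIrreducibleModPGaloisRep p) (h6 : MuLeFineMuAt W p) (hA : ConjAAt W p) :
    KatoDivisibilityAt W p :=
  (h6.muAlgZeroAt_of_fineMuZeroAt hA.fineMuZeroAt
      (exists_fineSelmerDualData_finite_isTorsion hmodP hfine hBCS hp hgood hord hirr)).katoDivisibilityAt
    hBCS hp hgood hord hirr

end MuZeroEngine

end Literature.NumberTheory.EllipticCurves.Rank1Residual

end
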